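import Mathlib.Combinatorics.Additive.PluenneckeRuzsa
import Mathlib.Combinatorics.Additive.Energy
import Mathlib.Analysis.SpecialFunctions.Pow.Real
import Mathlib.Algebra.Field.ZMod
import Mathlib.Algebra.GroupWithZero.Action.Pointwise.Finset

/-!
# Crux `DlogGraphFlat` (stmt-QuantumAdvantage-10732), line `Sketch` — sector A: the weak explicit
# sum–product theorem in `𝔽_p` from the Glibichuk–Konyagin dichotomy (`stub_dlogSumProductOfGK`)

`stub_dlogGKDichotomy`-statement `→` sum–product: for a zero-free `A ⊆ 𝔽_p` with `|A|² < p`,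
`|A + A| ≤ K|A|` and `|AA| ≤ K|A|` one has `|A| ≤ 8·12⁶ · K²⁰`. Garaev's scheme, arranged so
that only Mathlib's Ruzsa triangle inequalities and the single-summand Plünnecke–Ruzsa inequality
are used:

* `sumProd_mulEnergy_le_sum`: `E×(A) ≤ ∑_{(a,b) ∈ A²} |aA ∩ bA|` (fibrewise injection), so with
  Cauchy–Schwarz (`Finset.le_card_mul_mul_mulEnergy`) a popular `b₀` and the rich set
  `A₁ = {a : |A| ≤ 2K|aA ∩ b₀A|}` satisfy `|A| ≤ 2K|A₁|` (`sumProd_rich_subset`);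
* `sumProd_card_dilate_le`: Ruzsa's triangle inequalities with middle set `aA ∩ b₀A` give
  `|b₀A ± aA| ≤ 2K³|A|` for `a ∈ A₁`;
* `sumProd_card_six_le`: `a₁A − a₂A + ⋯ − a₆A` lies in the 6-fold sumset of
  `B = ⋃ ±aᵢA`, and Plünnecke–Ruzsa with base `b₀A` bounds it by `|b₀A + B|⁶ / |A|⁵`;
* the dichotomy (hypothesis) applied to `A₁` supplies `a₁, …, a₆ ∈ A₁` with
  `|A₁|² ≤ 2|a₁A − ⋯ − a₆A|`, whence `|A|² ≤ 8K² · 12⁶K¹⁸ · |A|` (`sumProd_bookkeeping`).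
-/

set_option linter.dupNamespace false -- D-0017: single-problem summit ⇒ `QuantumAdvantage.QuantumAdvantage` by design

namespace Summit.QuantumAdvantage.QuantumAdvantage.Theorems.SymplecticPurity

open Finset
open scoped Pointwise Combinatorics.Additive

/-- Subadditivity of the cardinality of a six-fold union. -/
theorem sumProd_card_union_six_le {α : Type*} [DecidableEq α] (U₁ U₂ U₃ U₄ U₅ U₆ : Finset α) :
    #(U₁ ∪ U₂ ∪ U₃ ∪ U₄ ∪ U₅ ∪ U₆) ≤ #U₁ + #U₂ + #U₃ + #U₄ + #U₅ + #U₆ := by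
  have h5 := card_union_le (U₁ ∪ U₂ ∪ U₃ ∪ U₄ ∪ U₅) U₆
  have h4 := card_union_le (U₁ ∪ U₂ ∪ U₃ ∪ U₄) U₅
  have h3 := card_union_le (U₁ ∪ U₂ ∪ U₃) U₄
  have h2 := card_union_le (U₁ ∪ U₂) U₃
  have h1 := card_union_le U₁ U₂
  omega

/-- **Final real bookkeeping.** `n ≤ 2Km`, `m² ≤ 2s` and `s · n⁶ ≤ (12K³n)⁶ · n` (with `n > 0`,
`K ≥ 1`) give `n ≤ 8·12⁶ · K²⁰ = 23887872 · K²⁰`. -/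
theorem sumProd_bookkeeping {n m s K : ℝ} (hn : 0 < n) (hK : 1 ≤ K) (h1 : n ≤ 2 * K * m)
    (h2 : m ^ 2 ≤ 2 * s) (h3 : s * n ^ 6 ≤ (12 * K ^ 3 * n) ^ 6 * n) :
    n ≤ 23887872 * K ^ 20 := by
  have hK0 : 0 < K := by linarith
  have hm0 : 0 ≤ m := by
    by_contra h
    have h' : 2 * K * m < 0 := mul_neg_of_pos_of_neg (by positivity) (not_le.1 h)
    linarith
  have h5 : n ^ 2 ≤ 8 * K ^ 2 * s :=
    calc n ^ 2 ≤ (2 * K * m) ^ 2 := by gcongr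
      _ = 4 * K ^ 2 * m ^ 2 := by ring
      _ ≤ 4 * K ^ 2 * (2 * s) := by gcongr
      _ = 8 * K ^ 2 * s := by ring
  have h6 : n * n ^ 7 ≤ 23887872 * K ^ 20 * n ^ 7 :=
    calc n * n ^ 7 = n ^ 2 * n ^ 6 := by ring
      _ ≤ 8 * K ^ 2 * s * n ^ 6 := by gcongr
      _ = 8 * K ^ 2 * (s * n ^ 6) := by ring
      _ ≤ 8 * K ^ 2 * ((12 * K ^ 3 * n) ^ 6 * n) := by gcongr
      _ = 23887872 * K ^ 20 * n ^ 7 := by ring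
  exact le_of_mul_le_mul_right h6 (by positivity)

section NoPrime

variable {p : ℕ}

/-- **Six-fold Plünnecke–Ruzsa bound through a common base set.** For a nonempty `X`,
`|P₁ − P₂ + P₃ − P₄ + P₅ − P₆| · |X|⁶ ≤ (|X + P₁| + |X − P₂| + ⋯ + |X − P₆|)⁶ · |X|`:
the alternating sum lies in the six-fold sumset of `B = P₁ ∪ (−P₂) ∪ ⋯ ∪ (−P₆)`, to which the
single-summand Plünnecke–Ruzsa inequality with base `X` applies, and `X + B` is the union of the
six sets `X ± Pᵢ`. -/
theorem sumProd_card_six_le (X P₁ P₂ P₃ P₄ P₅ P₆ : Finset (ZMod p)) (hX : X.Nonempty) :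
    #(P₁ - P₂ + P₃ - P₄ + P₅ - P₆) * #X ^ 6 ≤
      (#(X + P₁) + #(X - P₂) + #(X + P₃) + #(X - P₄) + #(X + P₅) + #(X - P₆)) ^ 6 * #X := by
  set B := P₁ ∪ -P₂ ∪ P₃ ∪ -P₄ ∪ P₅ ∪ -P₆ with hB
  have hmem : P₁ ⊆ B ∧ -P₂ ⊆ B ∧ P₃ ⊆ B ∧ -P₄ ⊆ B ∧ P₅ ⊆ B ∧ -P₆ ⊆ B := by
    refine ⟨?_, ?_, ?_, ?_, ?_, ?_⟩ <;> intro x hx <;> simp [hB, hx]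
  obtain ⟨m₁, m₂, m₃, m₄, m₅, m₆⟩ := hmem
  have hsub : P₁ - P₂ + P₃ - P₄ + P₅ - P₆ ⊆ (6 : ℕ) • B := by
    rw [show (6 : ℕ) = 1 + 1 + 1 + 1 + 1 + 1 from rfl, succ_nsmul, succ_nsmul, succ_nsmul,
      succ_nsmul, succ_nsmul, one_nsmul, sub_eq_add_neg, sub_eq_add_neg, sub_eq_add_neg]
    gcongr
  have hPR : #((6 : ℕ) • B) * #X ^ 6 ≤ #(X + B) ^ 6 * #X := by
    have h := pluennecke_ruzsa_inequality_nsmul_add hX B 6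
    have hX0 : (0 : ℚ≥0) < #X := by exact_mod_cast hX.card_pos
    rw [div_pow, div_mul_eq_mul_div, le_div_iff₀ (pow_pos hX0 _)] at h
    exact_mod_cast h
  have hXB : #(X + B) ≤
      #(X + P₁) + #(X - P₂) + #(X + P₃) + #(X - P₄) + #(X + P₅) + #(X - P₆) := by
    rw [hB, sub_eq_add_neg X P₂, sub_eq_add_neg X P₄, sub_eq_add_neg X P₆]
    simp only [add_union]
    exact sumProd_card_union_six_le _ _ _ _ _ _
  calc #(P₁ - P₂ + P₃ - P₄ + P₅ - P₆) * #X ^ 6 ≤ #((6 : ℕ) • B) * #X ^ 6 :=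
        Nat.mul_le_mul_right _ (card_le_card hsub)
    _ ≤ #(X + B) ^ 6 * #X := hPR
    _ ≤ _ := Nat.mul_le_mul_right _ (Nat.pow_le_pow_left hXB 6)

end NoPrime

section Prime

variable {p : ℕ} [Fact (Nat.Prime p)]

/-- Fibrewise bound for the multiplicative energy of a zero-free set:
`E×(A) ≤ ∑_{(a,b) ∈ A × A} |aA ∩ bA|` (for fixed `(a, b)` the solutions `(c, d) ∈ A²` of
`a c = b d` inject into `aA ∩ bA` via `(c, d) ↦ a c`). -/
theorem sumProd_mulEnergy_le_sum (A : Finset (ZMod p)) (h0 : (0 : ZMod p) ∉ A) :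
    Eₘ[A] ≤ ∑ ab ∈ A ×ˢ A, #(ab.1 • A ∩ ab.2 • A) := by
  unfold Finset.mulEnergy
  rw [card_eq_sum_card_fiberwise (f := fun x : (ZMod p × ZMod p) × ZMod p × ZMod p => x.1)
    (t := A ×ˢ A) (by
    rintro ⟨⟨a₁, a₂⟩, b₁, b₂⟩ hx
    simp only [coe_filter, mem_product, Set.mem_setOf_eq] at hx
    simp only [mem_coe, mem_product]
    exact ⟨hx.1.1.1, hx.1.1.2⟩)]
  refine sum_le_sum fun ab _ => ?_
  refine card_le_card_of_injOn (fun x => x.1.1 * x.2.1) ?_ ?_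
  · rintro ⟨⟨a₁, a₂⟩, b₁, b₂⟩ hx
    simp only [mem_coe, mem_filter, mem_product] at hx
    obtain ⟨⟨⟨-, hb₁, hb₂⟩, heq⟩, rfl⟩ := hx
    simp only [mem_coe, mem_inter, mem_smul_finset, smul_eq_mul]
    exact ⟨⟨b₁, hb₁, rfl⟩, ⟨b₂, hb₂, heq.symm⟩⟩
  · rintro ⟨⟨a₁, a₂⟩, b₁, b₂⟩ hx ⟨⟨c₁, c₂⟩, d₁, d₂⟩ hy hxy
    simp only [mem_coe, mem_filter, mem_product] at hx hy
    obtain ⟨⟨⟨⟨ha₁, ha₂⟩, -, -⟩, hxe⟩, hx1⟩ := hx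
    obtain ⟨⟨-, hye⟩, hy1⟩ := hy
    have hac : (a₁, a₂) = (c₁, c₂) := hx1.trans hy1.symm
    simp only [Prod.mk.injEq] at hac
    obtain ⟨rfl, rfl⟩ := hac
    simp only at hxy
    have hne₁ : a₁ ≠ 0 := fun h => h0 (h ▸ ha₁)
    have hne₂ : a₂ ≠ 0 := fun h => h0 (h ▸ ha₂)
    have e1 : b₁ = d₁ := mul_left_cancel₀ hne₁ hxy
    have e2 : b₂ = d₂ := mul_left_cancel₀ hne₂ (by rw [← hxe, hxy, hye])
    rw [e1, e2]

/-- **Popular element and rich subset.** If `A` is zero-free and nonempty, there are `b₀ ∈ A`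
and `A₁ ⊆ A` with `|A|² ≤ 2|AA| · |A₁|` and `|A|² ≤ 2|AA| · |aA ∩ b₀A|` for every `a ∈ A₁`
(from `|A|⁴ ≤ |AA| · E×(A)`, `sumProd_mulEnergy_le_sum` and averaging; all in `ℕ`). -/
theorem sumProd_rich_subset (A : Finset (ZMod p)) (h0 : (0 : ZMod p) ∉ A) (hA : A.Nonempty) :
    ∃ b₀ ∈ A, ∃ A₁ ⊆ A, #A ^ 2 ≤ 2 * #(A * A) * #A₁ ∧
      ∀ a ∈ A₁, #A ^ 2 ≤ 2 * #(A * A) * #(a • A ∩ b₀ • A) := by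
  obtain ⟨b₀, hb₀, hmax⟩ := exists_max_image A (fun b => ∑ a ∈ A, #(a • A ∩ b • A)) hA
  refine ⟨b₀, hb₀, A.filter (fun a => #A ^ 2 ≤ 2 * #(A * A) * #(a • A ∩ b₀ • A)),
    filter_subset _ _, ?_, fun a ha => (mem_filter.1 ha).2⟩
  -- Cauchy–Schwarz and the fibrewise bound: `|A|⁴ ≤ |AA| · |A| · ∑_a |aA ∩ b₀A|`.
  have hE : #A ^ 2 * #A ^ 2 ≤ #(A * A) * (#A * ∑ a ∈ A, #(a • A ∩ b₀ • A)) := by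
    calc #A ^ 2 * #A ^ 2 ≤ #(A * A) * Eₘ[A] := le_card_mul_mul_mulEnergy A A
      _ ≤ #(A * A) * ∑ ab ∈ A ×ˢ A, #(ab.1 • A ∩ ab.2 • A) :=
          Nat.mul_le_mul_left _ (sumProd_mulEnergy_le_sum A h0)
      _ = #(A * A) * ∑ b ∈ A, ∑ a ∈ A, #(a • A ∩ b • A) := by rw [sum_product_right]
      _ ≤ #(A * A) * (#A * ∑ a ∈ A, #(a • A ∩ b₀ • A)) := by
          refine Nat.mul_le_mul_left _ ?_
          have h := sum_le_card_nsmul A (fun b => ∑ a ∈ A, #(a • A ∩ b • A)) _ hmax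
          simpa only [smul_eq_mul] using h
  -- Split the sum along the rich set and its complement.
  have h1 : ∑ a ∈ A with #A ^ 2 ≤ 2 * #(A * A) * #(a • A ∩ b₀ • A), #(a • A ∩ b₀ • A) ≤
      #(A.filter (fun a => #A ^ 2 ≤ 2 * #(A * A) * #(a • A ∩ b₀ • A))) * #A := by
    have h := sum_le_card_nsmul
      (A.filter (fun a => #A ^ 2 ≤ 2 * #(A * A) * #(a • A ∩ b₀ • A)))
      (fun a => #(a • A ∩ b₀ • A)) #A
      (fun a _ => (card_le_card inter_subset_right).trans card_smul_finset_le)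
    simpa only [smul_eq_mul] using h
  have h2 : 2 * #(A * A) *
      ∑ a ∈ A with ¬ (#A ^ 2 ≤ 2 * #(A * A) * #(a • A ∩ b₀ • A)), #(a • A ∩ b₀ • A) ≤
      #A * #A ^ 2 := by
    rw [mul_sum]
    have h := sum_le_card_nsmul
      (A.filter (fun a => ¬ (#A ^ 2 ≤ 2 * #(A * A) * #(a • A ∩ b₀ • A))))
      (fun a => 2 * #(A * A) * #(a • A ∩ b₀ • A)) (#A ^ 2)
      (fun a ha => (not_le.1 (mem_filter.1 ha).2).le)
    simp only [smul_eq_mul] at h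
    exact h.trans (Nat.mul_le_mul_right _ (card_le_card (filter_subset _ _)))
  have hsplit := sum_filter_add_sum_filter_not A
    (fun a => #A ^ 2 ≤ 2 * #(A * A) * #(a • A ∩ b₀ • A)) (fun a => #(a • A ∩ b₀ • A))
  generalize ∑ a ∈ A with #A ^ 2 ≤ 2 * #(A * A) * #(a • A ∩ b₀ • A), #(a • A ∩ b₀ • A) = S₁
    at h1 hsplit
  generalize ∑ a ∈ A with ¬ (#A ^ 2 ≤ 2 * #(A * A) * #(a • A ∩ b₀ • A)), #(a • A ∩ b₀ • A) = S₂
    at h2 hsplit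
  rw [← hsplit] at hE
  generalize #(A.filter (fun a => #A ^ 2 ≤ 2 * #(A * A) * #(a • A ∩ b₀ • A))) = m at h1 ⊢
  generalize #(A * A) = M at hE h2 ⊢
  -- Bookkeeping in `ℕ`: `2|A|⁴ ≤ 2M|A|S₁ + |A|(2MS₂) ≤ 2Mm|A|² + |A|⁴`.
  have hn : 0 < #A := hA.card_pos
  have h1' : M * #A * S₁ ≤ M * #A * (m * #A) := Nat.mul_le_mul_left _ h1
  have h2' : #A * (2 * M * S₂) ≤ #A * (#A * #A ^ 2) := Nat.mul_le_mul_left _ h2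
  have key : #A ^ 2 * #A ^ 2 ≤ 2 * M * m * #A ^ 2 := by linarith
  exact Nat.le_of_mul_le_mul_right key (by positivity)

/-- **Ruzsa triangle inequalities with middle set `aA ∩ bA`.** For `a, b ≠ 0`:
`|bA + aA| · |aA ∩ bA| ≤ |A + A|²` and `|bA − aA| · |aA ∩ bA| ≤ |A + A|²`
(since `bA + (aA ∩ bA) ⊆ b(A + A)` and `aA + (aA ∩ bA) ⊆ a(A + A)`). -/
theorem sumProd_card_add_mul_inter_le (A : Finset (ZMod p)) {a b : ZMod p} (ha : a ≠ 0)
    (hb : b ≠ 0) :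
    #(b • A + a • A) * #(a • A ∩ b • A) ≤ #(A + A) ^ 2 ∧
      #(b • A - a • A) * #(a • A ∩ b • A) ≤ #(A + A) ^ 2 := by
  have h1 : #(b • A + a • A ∩ b • A) ≤ #(A + A) := by
    calc #(b • A + a • A ∩ b • A) ≤ #(b • A + b • A) :=
          card_le_card (add_subset_add_left inter_subset_right)
      _ = #(A + A) := by rw [← smul_add, card_smul_finset₀ hb]
  have h2 : #(a • A ∩ b • A + a • A) ≤ #(A + A) := by
    calc #(a • A ∩ b • A + a • A) ≤ #(a • A + a • A) :=
          card_le_card (add_subset_add_right inter_subset_left)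
      _ = #(A + A) := by rw [← smul_add, card_smul_finset₀ ha]
  have h3 : #(a • A + a • A ∩ b • A) ≤ #(A + A) := by
    calc #(a • A + a • A ∩ b • A) ≤ #(a • A + a • A) :=
          card_le_card (add_subset_add_left inter_subset_left)
      _ = #(A + A) := by rw [← smul_add, card_smul_finset₀ ha]
  constructor
  · calc #(b • A + a • A) * #(a • A ∩ b • A)
          ≤ #(b • A + a • A ∩ b • A) * #(a • A ∩ b • A + a • A) :=
        ruzsa_triangle_inequality_add_add_add _ _ _
      _ ≤ #(A + A) * #(A + A) := Nat.mul_le_mul h1 h2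
      _ = #(A + A) ^ 2 := (sq _).symm
  · calc #(b • A - a • A) * #(a • A ∩ b • A)
          ≤ #(b • A + a • A ∩ b • A) * #(a • A + a • A ∩ b • A) :=
        ruzsa_triangle_inequality_sub_add_add _ _ _
      _ ≤ #(A + A) * #(A + A) := Nat.mul_le_mul h1 h3
      _ = #(A + A) ^ 2 := (sq _).symm

/-- **Two-dilate sumset bounds on the rich set.** If `A` is nonempty, `a, b ≠ 0`,
`|A + A| ≤ K|A|`, `|AA| ≤ K|A|` and `|A|² ≤ 2|AA| · |aA ∩ bA|`, then `|bA + aA| ≤ 2K³|A|` and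
`|bA − aA| ≤ 2K³|A|`. -/
theorem sumProd_card_dilate_le (A : Finset (ZMod p)) (hA : A.Nonempty) {a b : ZMod p}
    (ha : a ≠ 0) (hb : b ≠ 0) {K : ℝ} (hK : 1 ≤ K) (hplus : (#(A + A) : ℝ) ≤ K * #A)
    (hmul : (#(A * A) : ℝ) ≤ K * #A) (hN : #A ^ 2 ≤ 2 * #(A * A) * #(a • A ∩ b • A)) :
    (#(b • A + a • A) : ℝ) ≤ 2 * K ^ 3 * #A ∧ (#(b • A - a • A) : ℝ) ≤ 2 * K ^ 3 * #A := by
  obtain ⟨h1, h2⟩ := sumProd_card_add_mul_inter_le A ha hb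
  have hK0 : (0 : ℝ) < K := by linarith
  have hn0 : (0 : ℝ) < #A := by exact_mod_cast hA.card_pos
  generalize #(a • A ∩ b • A) = N at h1 h2 hN
  have hNr : (#A : ℝ) ^ 2 ≤ 2 * (K * #A) * N := by
    calc (#A : ℝ) ^ 2 ≤ 2 * #(A * A) * N := by exact_mod_cast hN
      _ ≤ 2 * (K * #A) * N := by gcongr
  have key : ∀ m : ℕ, m * N ≤ #(A + A) ^ 2 → (m : ℝ) ≤ 2 * K ^ 3 * #A := by
    intro m hm
    have hm' : (m : ℝ) * N ≤ (K * #A) ^ 2 := by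
      calc (m : ℝ) * N ≤ (#(A + A) : ℝ) ^ 2 := by exact_mod_cast hm
        _ ≤ (K * #A) ^ 2 := by gcongr
    have hN0 : (0 : ℝ) < N := by
      by_contra hle
      have h : (N : ℝ) = 0 := le_antisymm (not_lt.1 hle) (Nat.cast_nonneg _)
      rw [h, mul_zero] at hNr
      linarith [pow_pos hn0 2]
    have h : (m : ℝ) * ((N : ℝ) * (#A : ℝ) ^ 2) ≤ 2 * K ^ 3 * #A * ((N : ℝ) * (#A : ℝ) ^ 2) := by
      calc (m : ℝ) * ((N : ℝ) * (#A : ℝ) ^ 2) = (m : ℝ) * N * (#A : ℝ) ^ 2 := by ring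
        _ ≤ (K * #A) ^ 2 * (2 * (K * #A) * N) :=
            mul_le_mul hm' hNr (by positivity) (by positivity)
        _ = 2 * K ^ 3 * #A * ((N : ℝ) * (#A : ℝ) ^ 2) := by ring
    exact le_of_mul_le_mul_right h (by positivity)
  exact ⟨key _ h1, key _ h2⟩

end Prime

/-- **Stub S1b (sector A, sum–product in `𝔽_p` from the dichotomy, weak explicit form; Garaev's
scheme).** The Glibichuk–Konyagin dichotomy (hypothesis) implies: for a zero-free `A ⊆ 𝔽_p` with
`|A|² < p`, `|A + A| ≤ K|A|` and `|AA| ≤ K|A|` one has `|A| ≤ C₀ K^{e₀}` with `C₀ = 8·12⁶`,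
`e₀ = 20`. Proof: `sumProd_rich_subset` gives `b₀` and the rich set `A₁` (`|A| ≤ 2K|A₁|`);
`sumProd_card_dilate_le` gives `|b₀A ± aA| ≤ 2K³|A|` on `A₁`; the dichotomy on `A₁` gives
`a₁, …, a₆ ∈ A₁` with `|A₁|² ≤ 2|a₁A − ⋯ − a₆A|`, and `sumProd_card_six_le` (Plünnecke–Ruzsa with
base `b₀A`) bounds the latter by `(12K³)⁶|A|`; `sumProd_bookkeeping` concludes. If `|A₁| ≤ 1`
then `|A| ≤ 2K` directly. -/
theorem stub_dlogSumProductOfGK :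
    (∀ (p : ℕ) [Fact (Nat.Prime p)] (A : Finset (ZMod p)), 2 ≤ A.card → A.card ^ 2 < p →
      ∃ a₁ ∈ A, ∃ a₂ ∈ A, ∃ a₃ ∈ A, ∃ a₄ ∈ A, ∃ a₅ ∈ A, ∃ a₆ ∈ A,
        A.card ^ 2 ≤ 2 * (a₁ • A - a₂ • A + a₃ • A - a₄ • A + a₅ • A - a₆ • A).card) →
    ∃ C₀ : ℝ, 0 < C₀ ∧ ∃ e₀ : ℝ, 0 < e₀ ∧
      ∀ (p : ℕ) [Fact (Nat.Prime p)] (A : Finset (ZMod p)) (K : ℝ),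
      (0 : ZMod p) ∉ A → A.Nonempty → 1 ≤ K → (A.card : ℝ) ^ 2 < (p : ℝ) →
      ((A + A).card : ℝ) ≤ K * A.card → ((A * A).card : ℝ) ≤ K * A.card →
      (A.card : ℝ) ≤ C₀ * K ^ e₀ := by
  intro hGK
  refine ⟨23887872, by norm_num, 20, by norm_num, ?_⟩
  intro p _ A K h0 hA hK hAp hplus hmul
  rw [show (20 : ℝ) = ((20 : ℕ) : ℝ) by norm_num, Real.rpow_natCast]
  have hK0 : (0 : ℝ) < K := by linarith
  have hn0 : (0 : ℝ) < #A := by exact_mod_cast hA.card_pos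
  obtain ⟨b₀, hb₀, A₁, hA₁A, hA₁n, hrich⟩ := sumProd_rich_subset A h0 hA
  have hb₀0 : b₀ ≠ 0 := fun h => h0 (h ▸ hb₀)
  have hA₁ : (#A : ℝ) ≤ 2 * K * #A₁ := by
    have h : (#A : ℝ) * #A ≤ 2 * K * #A₁ * #A := by
      calc (#A : ℝ) * #A = (#A : ℝ) ^ 2 := by ring
        _ ≤ 2 * #(A * A) * #A₁ := by exact_mod_cast hA₁n
        _ ≤ 2 * (K * #A) * #A₁ := by gcongr
        _ = 2 * K * #A₁ * #A := by ring
    exact le_of_mul_le_mul_right h hn0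
  rcases lt_or_ge #A₁ 2 with hsmall | hbig
  · -- Degenerate case `|A₁| ≤ 1`: `|A| ≤ 2K`.
    have h1 : (#A₁ : ℝ) ≤ 1 := by exact_mod_cast Nat.lt_succ_iff.1 hsmall
    have h2 : K ≤ K ^ 20 := le_self_pow₀ hK (by norm_num)
    calc (#A : ℝ) ≤ 2 * K * #A₁ := hA₁
      _ ≤ 2 * K * 1 := by gcongr
      _ ≤ 23887872 * K ^ 20 := by linarith
  -- Main case: apply the dichotomy to `A₁`.
  have hA₁p : #A₁ ^ 2 < p := by
    have h1 : #A₁ ^ 2 ≤ #A ^ 2 := Nat.pow_le_pow_left (card_le_card hA₁A) 2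
    have h2 : #A ^ 2 < p := by exact_mod_cast hAp
    exact lt_of_le_of_lt h1 h2
  obtain ⟨a₁, ha₁, a₂, ha₂, a₃, ha₃, a₄, ha₄, a₅, ha₅, a₆, ha₆, hcard⟩ := hGK p A₁ hbig hA₁p
  have hne : ∀ a ∈ A₁, a ≠ 0 := fun a ha h => h0 (h ▸ hA₁A ha)
  -- Two-dilate bounds on the rich set.
  have hd : ∀ a ∈ A₁, (#(b₀ • A + a • A) : ℝ) ≤ 2 * K ^ 3 * #A ∧
      (#(b₀ • A - a • A) : ℝ) ≤ 2 * K ^ 3 * #A :=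
    fun a ha => sumProd_card_dilate_le A hA (hne a ha) hb₀0 hK hplus hmul (hrich a ha)
  -- Six-fold Plünnecke–Ruzsa with base `b₀A`, and the dichotomy bound moved from `A₁` to `A`.
  have hC := sumProd_card_six_le (b₀ • A) (a₁ • A) (a₂ • A) (a₃ • A) (a₄ • A) (a₅ • A) (a₆ • A)
    hA.smul_finset
  rw [card_smul_finset₀ hb₀0 A] at hC
  have hS₁ : a₁ • A₁ - a₂ • A₁ + a₃ • A₁ - a₄ • A₁ + a₅ • A₁ - a₆ • A₁ ⊆
      a₁ • A - a₂ • A + a₃ • A - a₄ • A + a₅ • A - a₆ • A := by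
    gcongr
  replace hcard := hcard.trans (Nat.mul_le_mul_left 2 (card_le_card hS₁))
  generalize #(a₁ • A - a₂ • A + a₃ • A - a₄ • A + a₅ • A - a₆ • A) = s at hcard hC
  obtain ⟨h1p, -⟩ := hd a₁ ha₁
  obtain ⟨-, h2m⟩ := hd a₂ ha₂
  obtain ⟨h3p, -⟩ := hd a₃ ha₃
  obtain ⟨-, h4m⟩ := hd a₄ ha₄
  obtain ⟨h5p, -⟩ := hd a₅ ha₅
  obtain ⟨-, h6m⟩ := hd a₆ ha₆
  generalize #(b₀ • A + a₁ • A) = u₁ at h1p hC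
  generalize #(b₀ • A - a₂ • A) = u₂ at h2m hC
  generalize #(b₀ • A + a₃ • A) = u₃ at h3p hC
  generalize #(b₀ • A - a₄ • A) = u₄ at h4m hC
  generalize #(b₀ • A + a₅ • A) = u₅ at h5p hC
  generalize #(b₀ • A - a₆ • A) = u₆ at h6m hC
  have hsum : ((u₁ + u₂ + u₃ + u₄ + u₅ + u₆ : ℕ) : ℝ) ≤ 12 * K ^ 3 * #A := by
    push_cast
    linarith
  have hCR : (s : ℝ) * (#A : ℝ) ^ 6 ≤ (12 * K ^ 3 * #A) ^ 6 * #A :=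
    calc (s : ℝ) * (#A : ℝ) ^ 6 ≤ ((u₁ + u₂ + u₃ + u₄ + u₅ + u₆ : ℕ) : ℝ) ^ 6 * #A := by
          exact_mod_cast hC
      _ ≤ (12 * K ^ 3 * #A) ^ 6 * #A := by gcongr
  have hcardR : (#A₁ : ℝ) ^ 2 ≤ 2 * s := by exact_mod_cast hcard
  exact sumProd_bookkeeping hn0 hK hA₁ hcardR hCR

end Summit.QuantumAdvantage.QuantumAdvantage.Theorems.SymplecticPurity
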